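/-
Copyright (c) 2026 the pub-hodgecm-mathlib formalisation cell (harness21).  Prover seat hodgecm-mathlib-LH4-p07 (g9), req620 Track A «(D-RAM) FOUR-FRAME» squad
(STAGE-1b, row-(2) lineage; dealer LH4-plan (g13) WORD #94 (1) ∕ #97: the RamM lane of the level law — near-1 tokens), 2026-09-04.
-/
import Summits.HodgeConjecture.HodgeConjecture.Theorems.F0P3cDyRamLevelsSocketPrelude   -- ★ p860127 (this seat): eigenvalue token letters; brings ★ p859341 GUARD LETTER
import HarnessLib

/-!
# Crux `H413`, line LH4 «(D-RAM) FOUR-FRAME» — STAGE-1b, row (2): (SOCKET-lev TOKENS, RamM) «THE LEVEL PIECE'S TOKENS NEAR 1 WHEN `M ∕ E` IS RAMIFIED»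

Cell `hodgecm-mathlib` (D-0151), FLOOR 0, crux item H413 = `stmt-HodgeConjecture-24833`, route of record `HCCMUnconditional`; squad F0∕P3c∕LH4; lane
`--supports stmt-HodgeConjecture-24833 --as helper` (count-neutral; pays NO tier-0 row).  THEOREMS ONLY (no `def`, no instance, no notation, no `sorry`).
OWNER'S ORGAN №18 — the RamM twin of ★ p860370 `levelTokens_near_one`: the frame letter is now `|jE x| = |x|²` (so `|jEϖ| = exp(−2)`), the depth token of `lam − jE u`
is in POWER form `|jEϖ|^m` (★ `orderCountCensusC`'s `hμ`), and the trace-level token of `lam + jE u − 2` is returned in EXP form `exp(−kν)` with `2b ≤ kν` — its PARITY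
is free near 1 (`(lam − 1) + jE(u − 1)`, `|lam − 1|` any integer power), whence the square multiplier's depth `|μ₂| = |jEϖ|^{m−b}·exp(−kν)` is returned un-normalised
(the even-`kν` population feeds ★ p860481 §1∕§2 with `m₂ := m − b + kν∕2`; the odd one waits for (R0) of `SCOPE-RamM-lane.v1`).  **`levelTokens_near_one_ramM`**.
HONEST LABEL.  Count-neutral; `HC_CM` is proved only modulo the 7 printed citations (2 remaining named inputs: hLiu418 = `stmt-HodgeConjecture-24832`, h413 =
`stmt-HodgeConjecture-24833`) until rung 0 closes.

## References
* [Rogawski1990] J. D. Rogawski, *Automorphic Representations of Unitary Groups in Three Variables*, Ann. of Math. Stud. 123 (1990): §4.9 Prop. 4.9.1 (b) p. 55, Lemma 4.9.3 p. 56.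
* [Serre1979] J.-P. Serre, *Local Fields*, GTM 67 (1979): Ch. II §1; Ch. III §6 Prop. 12.
-/

set_option autoImplicit false

namespace Summit.HodgeConjecture.HodgeConjecture.Cruxes.H413.F0P3cDyRamLevelsSocketTokensRamM

open WithZero
open scoped Valued
open Summit.HodgeConjecture.HodgeConjecture.Cruxes.H413.F0P3cDyRamLevelsSocketPrelude
open Summit.HodgeConjecture.HodgeConjecture.Cruxes.H413.F0P3cDyRamJointProfileCensusGuardLetter (sub_one_sq_sub_map_sub_one_sq)

-- `M : Type`: ★ p859341 GUARD LETTER is stated in universe 0; the sockets instantiate `M := E′_{w₁}`.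
variable {E : Type*} {M : Type} [Field E] [Valued E ℤᵐ⁰] [Field M] [Valued M ℤᵐ⁰] {ρ : M →+* M}

/-- **(SOCKET-lev TOKENS, RamM) THE LEVEL PIECE'S TOKENS NEAR 1, `M ∕ E` RAMIFIED.**  See the module docstring.
[cite: Rogawski1990, §4.9 Prop. 4.9.1 (b) p. 55, Lemma 4.9.3 p. 56] [cite: Serre1979, Ch. II §1; Ch. III §6 Prop. 12] -/
theorem levelTokens_near_one_ramM (jE : E →+* M) (hvρ : ∀ x, Valued.v (ρ x) = Valued.v x) (hjv2 : ∀ x, Valued.v (jE x) = Valued.v x ^ 2)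
    (hρj : ∀ x, ρ (jE x) = jE x) {ϖ : E} (hϖ : Valued.v ϖ = exp (-1 : ℤ))
    {lam : M} {tr det u : E} (hρlam : ρ lam = jE tr - lam) (hlam2 : lam * lam = jE tr * lam - jE det)
    {α : M} (hα0 : ρ α ≠ α) {jl m : ℕ} (hjlv : Valued.v (lam - ρ lam) = Valued.v (jE ϖ) ^ jl * Valued.v (α - ρ α))
    (hm : Valued.v (lam - jE u) = Valued.v (jE ϖ) ^ m) {a b : ℕ} (hab : a ≤ b) (ham : a ≤ m) (hbm : b ≤ m)
    (hdet : Valued.v (det - 1) ≤ Valued.v ϖ ^ (2 * b)) (htr : Valued.v (tr - 2) ≤ Valued.v ϖ ^ (2 * b))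
    (hu1 : Valued.v (u - 1) ≤ Valued.v ϖ ^ (2 * b)) :
    ∃ kν : ℕ, 2 * b ≤ kν ∧ Valued.v (lam + jE u - 2) = exp (-(kν : ℤ)) ∧
      Valued.v ((jE ϖ ^ a)⁻¹ * (lam - jE u)) = Valued.v (jE ϖ) ^ (m - a) ∧
      Valued.v ((jE ϖ ^ b)⁻¹ * ((lam - 1) * (lam - 1) - jE ((u - 1) ^ 2))) = Valued.v (jE ϖ) ^ (m - b) * exp (-(kν : ℤ)) ∧
      Valued.v (lam - 1) ≤ Valued.v (jE ϖ ^ a) ∧ Valued.v ((lam - 1) * (lam - 1)) ≤ Valued.v (jE ϖ ^ b) ∧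
      Valued.v (lam + ρ lam - 2) ≤ Valued.v (jE ϖ) ^ (b - a) ∧
      Valued.v (u - 1) ≤ Valued.v ϖ ^ a ∧ Valued.v ((u - 1) ^ 2) ≤ Valued.v ϖ ^ b := by
  have hϖE : Valued.v (jE ϖ) = exp (-2 : ℤ) := by rw [hjv2, hϖ, ← exp_nsmul]; rfl
  have hϖE0 : jE ϖ ≠ 0 := fun h0 => by rw [h0, map_zero] at hϖE; exact zero_ne_coe hϖE
  have hϖE' : Valued.v (jE ϖ) = Valued.v ϖ ^ 2 := hjv2 ϖ
  have hpowE : ∀ k l : ℕ, l ≤ k → Valued.v ϖ ^ k ≤ Valued.v ϖ ^ l := fun k l h => (pow_le_pow_iff_of_uniformiser hϖ k l).2 h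
  have hpowM : ∀ k l : ℕ, l ≤ k → Valued.v (jE ϖ) ^ k ≤ Valued.v (jE ϖ) ^ l := fun k l h => by
    rw [hϖE', ← pow_mul, ← pow_mul]; exact hpowE _ _ (by omega)
  -- `lam` is moved by `ρ`
  have hlamne : ρ lam ≠ lam := fun h0 => by
    have h1 := hjlv
    rw [h0, sub_self, map_zero] at h1
    exact (mul_ne_zero (pow_ne_zero _ ((Valuation.ne_zero_iff _).2 hϖE0)) ((Valuation.ne_zero_iff _).2 (sub_ne_zero.2 (Ne.symm hα0)))) h1.symm
  obtain ⟨-, hν0⟩ := sub_ne_zero_and_add_sub_two_ne_zero hlamne (hρj u)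
  -- `|lam − 1| ≤ |ϖ|^{2b} = |jEϖ|^b` and its consequences
  have hlam1 : Valued.v (lam - 1) ≤ Valued.v (jE ϖ) ^ b := by
    rw [hϖE', ← pow_mul]
    refine (pow_le_pow_iff_left₀ zero_le zero_le two_ne_zero).1 ?_
    rw [pow_two, v_sub_one_mul_self_eq jE hvρ hρlam hlam2, hjv2, show det - tr + 1 = (det - 1) - (tr - 2) by ring, ← pow_mul, show 2 * b * 2 = 2 * b + 2 * b by ring,
      pow_add]
    exact pow_le_pow_left₀ zero_le ((Valuation.map_sub _ _ _).trans (max_le hdet htr)) 2 |>.trans (by rw [pow_two])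
  have hlev : Valued.v (lam - 1) ≤ Valued.v (jE ϖ ^ a) := by rw [map_pow]; exact hlam1.trans (hpowM b a hab)
  have hlev2 : Valued.v ((lam - 1) * (lam - 1)) ≤ Valued.v (jE ϖ ^ b) := by
    rw [map_mul, map_pow]
    calc Valued.v (lam - 1) * Valued.v (lam - 1) ≤ Valued.v (jE ϖ) ^ b * Valued.v (jE ϖ) ^ b := mul_le_mul' hlam1 hlam1
      _ = Valued.v (jE ϖ) ^ (2 * b) := by rw [← pow_add, two_mul]
      _ ≤ Valued.v (jE ϖ) ^ b := hpowM _ _ (by omega)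
  have hdeep : Valued.v (lam + ρ lam - 2) ≤ Valued.v (jE ϖ) ^ (b - a) := by
    rw [add_map_sub_two_eq jE hρlam, hjv2, hϖE', ← pow_mul]
    calc Valued.v (tr - 2) ^ 2 ≤ (Valued.v ϖ ^ (2 * b)) ^ 2 := pow_le_pow_left₀ zero_le htr 2
      _ = Valued.v ϖ ^ (2 * (2 * b)) := by rw [← pow_mul, mul_comm (2 * b) 2]
      _ ≤ Valued.v ϖ ^ (2 * (b - a)) := hpowE _ _ (by omega)
  have huc : Valued.v (u - 1) ≤ Valued.v ϖ ^ a := hu1.trans (hpowE _ _ (by omega))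
  have huc2 : Valued.v ((u - 1) ^ 2) ≤ Valued.v ϖ ^ b := by
    rw [map_pow, pow_two]
    calc Valued.v (u - 1) * Valued.v (u - 1) ≤ Valued.v ϖ ^ (2 * b) * Valued.v ϖ ^ (2 * b) := mul_le_mul' hu1 hu1
      _ = Valued.v ϖ ^ (4 * b) := by rw [← pow_add]; ring_nf
      _ ≤ Valued.v ϖ ^ b := hpowE _ _ (by omega)
  -- the trace-level token `kν ≥ 2b` of `lam + jE u − 2 = (lam − 1) + jE (u − 1)`, exp form
  have hνle : Valued.v (lam + jE u - 2) ≤ exp (-((2 * b : ℕ) : ℤ)) := by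
    rw [show lam + jE u - 2 = (lam - 1) + jE (u - 1) by rw [map_sub, map_one]; ring]
    refine (Valuation.map_add _ _ _).trans (max_le (hlam1.trans ?_) ?_)
    · rw [hϖE, ← exp_nsmul, nsmul_eq_mul, exp_le_exp]; push_cast; omega
    · rw [hjv2]
      refine (pow_le_pow_left₀ zero_le hu1 2).trans ?_
      rw [← pow_mul, hϖ, ← exp_nsmul, nsmul_eq_mul, exp_le_exp]; push_cast; omega
  have hv0 : Valued.v (lam + jE u - 2) ≠ 0 := (Valuation.ne_zero_iff _).2 hν0
  obtain ⟨k, hk⟩ : ∃ k : ℤ, Valued.v (lam + jE u - 2) = exp k := ⟨_, (exp_log hv0).symm⟩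
  have hk2b : k ≤ -((2 * b : ℕ) : ℤ) := by rw [hk, exp_le_exp] at hνle; exact hνle
  refine ⟨(-k).toNat, by omega, by rw [hk, Int.toNat_of_nonneg (by omega), neg_neg], ?_, ?_, hlev, hlev2, hdeep, huc, huc2⟩
  · rw [map_mul, map_inv₀, map_pow, hm, ← zpow_natCast, ← zpow_natCast, ← zpow_neg, ← zpow_add₀ ((Valuation.ne_zero_iff _).2 hϖE0), ← zpow_natCast]
    congr 1; omega
  · rw [sub_one_sq_sub_map_sub_one_sq, map_mul, map_inv₀, map_pow, map_mul, hm, hk, Int.toNat_of_nonneg (by omega), neg_neg, ← mul_assoc]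
    congr 1
    rw [← zpow_natCast, ← zpow_natCast, ← zpow_neg, ← zpow_add₀ ((Valuation.ne_zero_iff _).2 hϖE0), ← zpow_natCast]
    congr 1; omega

end Summit.HodgeConjecture.HodgeConjecture.Cruxes.H413.F0P3cDyRamLevelsSocketTokensRamM
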